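import Mathlib
import Literature.NumberTheory.Sieve.Maynard2016Lemma7Solvable
import Literature.NumberTheory.Sieve.Maynard2016CoupledKernel
import HarnessLib

/-!
# Maynard (2016), Lemma 7: the contributing tuples are exactly the coupled-admissible ones

Topic `Literature/NumberTheory/Sieve`; trunk AntSieve / parity (Maynard 2016 large-gaps ladder, named
fact `Literature.NumberTheory.Sieve.Maynard2016.Lemma7Tuple` of `Maynard2016Lemma7PerTuple.lean`).

J. Maynard, *Large gaps between primes*, Ann. of Math. (2) 183 (2016), 915–933 = arXiv:1408.5110,
§6, proof of Lemma 7, p. 12–13: after (Div1)–(Div3) "we can now evaluate the complete sums … in a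
manner essentially identical to that of Lemma 6" (display (6.32)).  In the tree, the main term of
Lemma 6 was evaluated by the coupled Euler-product engine of `Maynard2016CoupledEuler` /
`Maynard2016CoupledKernel` (summation condition `LcmEuler.CoupledAdm W m M`: the `[d_j,d'_j]`
pairwise coprime and coprime to `W`, the `[e_l,e'_l]` likewise and coprime to `m`, and a prime
dividing both `[d_j,d'_j]` and `[e_l,e'_l]` lies in the coupling set `M p`).  This file identifies
the solvability condition `SysSolvable` of Lemma 7 (`Maynard2016Lemma7ErrorSplit`) with
`CoupledAdm (P_w) m (couplingSet7 p₀)` for the LEMMA-7 COUPLING SET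
`couplingSet7 p₀ p = {(j,l) : l ≠ j, p ∣ m p₀ (h_l − h_j) + (h_j − h_i)}`, so that the main term
`S_i = Σ_{SysSolvable} λλ'/φ(radMod)` of (6.32) is the `φ`-weighted coupled sum of the same engine.

PROVED here (no named facts): `couplingSet7`, `mem_couplingSet7`, `card_couplingSet7_le` (`≤ k²`),
and **`sysSolvable_iff_coupledAdm`** — on the support of `λ_{d,e}λ_{d',e'}` restricted to slot `i`
trivial (squarefree coordinates, `d_j d'_j < p₀`, `(m p₀ − 1, e_l e'_l) = 1`,
`d_i = d'_i = e_i = e'_i = 1`) and for large `x` (every prime factor of `h_a − h_b` divides `P_w`):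
`SysSolvable ↔ CoupledAdm (P_w) m (couplingSet7 p₀) (d,d') (e,e')`.

## References

* J. Maynard, *Large gaps between primes*, Ann. of Math. (2) 183 (2016), 915–933; arXiv:1408.5110,
  §6, proof of Lemma 7, (Div1)–(Div3) and display (6.32). [Maynard2016LargeGaps]
-/

noncomputable section

open Finset
open scoped BigOperators Classical

namespace Literature.NumberTheory.Sieve

namespace Maynard2016

open LcmEuler

variable {k : ℕ}

/-! ### The Lemma-7 coupling set -/

/-- The coupling set of Lemma 7 at the prime `p` (for the tuple element `h_i`, the modulus `m` and the
prime `p₀`): `{(j, l) : l ≠ j, p ∣ m p₀ (h_l − h_j) + (h_j − h_i)}`. [cite: Maynard2016LargeGaps, Lemma 7 (proof, (Div3))] -/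
def couplingSet7 (k x m p₀ : ℕ) (i : Fin k) (p : ℕ) : Finset (Fin k × Fin k) :=
  Finset.univ.filter (fun jl : Fin k × Fin k => jl.2 ≠ jl.1 ∧
    (p : ℤ) ∣ (m : ℤ) * p₀ * ((hTuple k x jl.2 : ℤ) - hTuple k x jl.1) +
      ((hTuple k x jl.1 : ℤ) - hTuple k x i))

/-- Membership in `couplingSet7`. [cite: Maynard2016LargeGaps, Lemma 7 (proof, (Div3))] -/
theorem mem_couplingSet7 {k x m p₀ : ℕ} {i : Fin k} {p : ℕ} {j l : Fin k} :
    (j, l) ∈ couplingSet7 k x m p₀ i p ↔ l ≠ j ∧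
      (p : ℤ) ∣ (m : ℤ) * p₀ * ((hTuple k x l : ℤ) - hTuple k x j) +
        ((hTuple k x j : ℤ) - hTuple k x i) := by
  simp [couplingSet7]

/-- `#couplingSet7 ≤ k²`. [cite: Maynard2016LargeGaps, Lemma 7 (proof, "K_p ≪ p⁻¹")] -/
theorem card_couplingSet7_le (k x m p₀ : ℕ) (i : Fin k) (p : ℕ) :
    (couplingSet7 k x m p₀ i p).card ≤ k * k := by
  refine (Finset.card_filter_le _ _).trans ?_
  simp [Finset.card_univ]

/-! ### Helpers -/

/-- `IsCoprime A (D : ℤ)` from "no prime factor of `D` divides `A`". [cite: Maynard2016LargeGaps, Lemma 7 (proof, (Div1)–(Div3))] -/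
theorem isCoprime_natCast_of_forall_prime {A : ℤ} {D : ℕ}
    (h : ∀ p : ℕ, p.Prime → p ∣ D → ¬ (p : ℤ) ∣ A) : IsCoprime A (D : ℤ) := by
  rw [Int.isCoprime_iff_gcd_eq_one, Int.gcd_comm]
  have h1 : Nat.Coprime D A.natAbs :=
    Nat.coprime_of_dvd fun p hp hpD hpA => h p hp hpD (Int.natCast_dvd.2 hpA)
  show Nat.gcd ((D : ℤ).natAbs) A.natAbs = 1
  rw [Int.natAbs_natCast]
  exact h1

/-- A prime dividing two coprime naturals: impossible. [cite: Maynard2016LargeGaps, Lemma 7 (proof, (Div1))] -/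
theorem not_dvd_of_coprime {p a b : ℕ} (hp : p.Prime) (hab : Nat.Coprime a b) (ha : p ∣ a) :
    ¬ p ∣ b := fun hb =>
  hp.one_lt.ne' (Nat.dvd_one.1 (by have := Nat.dvd_gcd ha hb; rwa [hab] at this))

/-! ### `SysSolvable ↔ CoupledAdm` -/

/-- **The contributing tuples of Lemma 7 are the coupled-admissible ones.**  On the support of
`λ_{d,e} λ_{d',e'}` with slot `i` trivial and for large `x`:
`SysSolvable ↔ CoupledAdm P_w m (couplingSet7 p₀) (d,d') (e,e')`. [cite: Maynard2016LargeGaps, Lemma 7 (proof, (Div1)–(Div3), display (6.32))] -/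
theorem sysSolvable_iff_coupledAdm {x m p₀ : ℕ} (hp₀ : p₀.Prime) (hm : 1 ≤ m)
    (hW : ∀ a b : Fin k, a ≠ b → ∀ p : ℕ, p.Prime →
      (p : ℤ) ∣ (hTuple k x b : ℤ) - hTuple k x a → p ∣ Pw x)
    {i : Fin k} {d d' e e' : Fin k → ℕ}
    (hd : ∀ j, Squarefree (d j)) (hd' : ∀ j, Squarefree (d' j)) (he : ∀ j, Squarefree (e j))
    (he' : ∀ j, Squarefree (e' j)) (hdlt : ∀ j, d j * d' j < p₀)
    (hecop : ∀ j, Nat.Coprime (m * p₀ - 1) (e j * e' j))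
    (hdi : d i = 1) (hdi' : d' i = 1) (hei : e i = 1) (hei' : e' i = 1) :
    SysSolvable k x m p₀ i d d' e e' ↔
      CoupledAdm (Pw x) m (couplingSet7 k x m p₀ i) (d, d') (e, e') := by
  have hd0 : ∀ j, d j ≠ 0 := fun j => (hd j).ne_zero
  have hd0' : ∀ j, d' j ≠ 0 := fun j => (hd' j).ne_zero
  have hmp1 : 1 ≤ m * p₀ := Nat.one_le_iff_ne_zero.2 (Nat.mul_ne_zero (by omega) hp₀.ne_zero)
  have hmp : ((m * p₀ - 1 : ℕ) : ℤ) = (m : ℤ) * p₀ - 1 := by push_cast [Nat.cast_sub hmp1]; ring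
  constructor
  · intro hsol
    have hsol' := hsol
    obtain ⟨q, hq⟩ := hsol'
    -- the `e`-side congruence at slot `l`, unfolded
    have hEq : ∀ l, ((Nat.lcm (e l) (e' l) : ℕ) : ℤ) ∣
        (m : ℤ) * p₀ - 1 + (m : ℤ) * ((hTuple k x l : ℤ) - hTuple k x i) * q := by
      intro l
      have := hq (Sum.inr l) (Finset.mem_univ _)
      simpa only [sysD, sysP, sysA, Sum.elim_inr] using this
    refine ⟨⟨fun j₁ j₂ hne => coprime_dd_of_sysSolvable hp₀ hW hd0 hd0' hdlt hsol hne,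
      fun j => ?_⟩, ⟨fun l₁ l₂ hne => coprime_ee_of_sysSolvable hm hW hecop hsol hne, fun l => ?_⟩,
      fun l => ?_, fun p hp j l h₁ h₂ => ?_⟩
    · -- `([d_j,d'_j], P_w) = 1`
      refine Nat.coprime_of_dvd fun p hp h hPw => ?_
      exact not_dvd_p₀_of_dvd_lcm hp₀ hp hd0 hd0' hdlt h
        (Int.natCast_dvd_natCast.1 (dvd_p₀_of_dvd_lcm_of_dvd_Pw hq h hPw))
    · -- `([e_l,e'_l], P_w) = 1`
      refine Nat.coprime_of_dvd fun p hp h hPw => ?_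
      have h1 : (p : ℤ) ∣ (m : ℤ) * p₀ - 1 + (m : ℤ) * ((hTuple k x l : ℤ) - hTuple k x i) * q :=
        (Int.natCast_dvd_natCast.2 h).trans (hEq l)
      have h2 : (p : ℤ) ∣ (m : ℤ) * ((hTuple k x l : ℤ) - hTuple k x i) * q :=
        (((Int.natCast_dvd_natCast.2 (hPw.trans (Pw_dvd_hTuple k x l))).sub
          (Int.natCast_dvd_natCast.2 (hPw.trans (Pw_dvd_hTuple k x i)))).mul_left _).mul_right _
      have h3 : (p : ℤ) ∣ (m : ℤ) * p₀ - 1 := (dvd_add_left h2).1 h1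
      rw [← hmp, Int.natCast_dvd_natCast] at h3
      exact not_dvd_of_coprime hp (hecop l) h3 (h.trans (Nat.lcm_dvd_mul _ _))
    · -- `([e_l,e'_l], m) = 1`
      refine Nat.coprime_of_dvd fun p hp h hpm => ?_
      have h1 : (p : ℤ) ∣ (m : ℤ) * p₀ - 1 + (m : ℤ) * ((hTuple k x l : ℤ) - hTuple k x i) * q :=
        (Int.natCast_dvd_natCast.2 h).trans (hEq l)
      have h2 : (p : ℤ) ∣ (m : ℤ) * p₀ + (m : ℤ) * ((hTuple k x l : ℤ) - hTuple k x i) * q :=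
        ((Int.natCast_dvd_natCast.2 hpm).mul_right _).add
          (((Int.natCast_dvd_natCast.2 hpm).mul_right _).mul_right _)
      have h3 : (p : ℤ) ∣ 1 := by
        have := h2.sub h1
        simpa using this
      exact hp.one_lt.ne' (Nat.dvd_one.1 (Int.natCast_dvd_natCast.1 (by simpa using h3)))
    · -- the coupling
      rw [mem_couplingSet7]
      refine ⟨fun hlj => ?_, dvd_coupling_of_sysSolvable hsol h₁ h₂⟩
      subst hlj
      exact not_dvd_of_coprime hp (coprime_de_of_sysSolvable hp₀ hW hd0 hd0' hdlt hsol l) h₁ h₂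
  · rintro ⟨hD, hE, hEm, hM⟩
    -- units
    have hunit : ∀ t, IsCoprime (sysA k x i m t) (sysD d d' e e' t : ℤ) := by
      rintro (j | l)
      · simp only [sysA, sysD, Sum.elim_inl]
        by_cases hji : j = i
        · subst hji
          rw [hdi, hdi', Nat.lcm_one_left, Nat.cast_one]
          exact isCoprime_one_right
        · refine isCoprime_natCast_of_forall_prime fun p hp hpD hpA => ?_
          exact not_dvd_of_coprime hp (hD.2 j) hpD (hW i j (Ne.symm hji) p hp hpA)
      · simp only [sysA, sysD, Sum.elim_inr]
        by_cases hli : l = i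
        · subst hli
          rw [hei, hei', Nat.lcm_one_left, Nat.cast_one]
          exact isCoprime_one_right
        · refine isCoprime_natCast_of_forall_prime fun p hp hpE hpA => ?_
          have hpZ : Prime (p : ℤ) := Nat.prime_iff_prime_int.mp hp
          rcases hpZ.dvd_or_dvd hpA with h1 | h1
          · exact not_dvd_of_coprime hp (hEm l) hpE (Int.natCast_dvd_natCast.1 h1)
          · exact not_dvd_of_coprime hp (hE.2 l) hpE (hW i l (Ne.symm hli) p hp h1)
    -- prime-by-prime compatibility
    have hcompat : ∀ p : ℕ, p.Prime → ∀ t₁ t₂, p ∣ sysD d d' e e' t₁ → p ∣ sysD d d' e e' t₂ →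
        (p : ℤ) ∣ sysA k x i m t₂ * sysP k m p₀ t₁ - sysA k x i m t₁ * sysP k m p₀ t₂ := by
      intro p hp t₁ t₂ h₁ h₂
      rcases t₁ with j₁ | l₁ <;> rcases t₂ with j₂ | l₂
      · by_cases hj : j₁ = j₂
        · subst hj; simp
        · change p ∣ Nat.lcm (d j₁) (d' j₁) at h₁
          change p ∣ Nat.lcm (d j₂) (d' j₂) at h₂
          exact absurd h₂ (not_dvd_of_coprime hp (hD.1 j₁ j₂ hj) h₁)
      · change p ∣ Nat.lcm (d j₁) (d' j₁) at h₁
        change p ∣ Nat.lcm (e l₂) (e' l₂) at h₂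
        rw [cross_inl_inr]
        exact (mem_couplingSet7.1 (hM p hp j₁ l₂ h₁ h₂)).2
      · change p ∣ Nat.lcm (e l₁) (e' l₁) at h₁
        change p ∣ Nat.lcm (d j₂) (d' j₂) at h₂
        rw [cross_inr_inl]
        exact (dvd_neg).2 (mem_couplingSet7.1 (hM p hp j₂ l₁ h₂ h₁)).2
      · by_cases hl : l₁ = l₂
        · subst hl; simp
        · change p ∣ Nat.lcm (e l₁) (e' l₁) at h₁
          change p ∣ Nat.lcm (e l₂) (e' l₂) at h₂
          exact absurd h₂ (not_dvd_of_coprime hp (hE.1 l₁ l₂ hl) h₁)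
    obtain ⟨c, hc, hiff⟩ := exists_sqfSystem_iff_mod_eq (Finset.univ : Finset (Fin k ⊕ Fin k))
      (sysD d d' e e') (sysP k m p₀) (sysA k x i m) (sys_squarefree hd hd' he he')
      (fun t _ => hunit t) (fun p hp t₁ _ t₂ _ h₁ h₂ => hcompat p hp t₁ t₂ h₁ h₂)
    exact ⟨c, (hiff c).2 (Nat.mod_eq_of_lt hc)⟩

end Maynard2016

end Literature.NumberTheory.Sieve

end
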